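import Literature.NumberTheory.LFunctions.WeilExplicit
import HarnessLib

/-!
# VERTICAL SHIFT = COHERENTLY DRESSED STEINHAUS TWIST: the orbit dictionary of the
# random-multiplicative-function family (pub-rhpf FAKE SEAT 4, gen 4; helper for item stmt-RiemannHypothesis-19953)

**mechanism/rigidity campaign; no RH claims.**  Everything in this file is an RH-free, sorry-free, hypothesis-free
identity between Bochner integrals / `tsum`s of the tree's Weil-functional API
(`Literature.NumberTheory.LFunctions.WeilExplicit`), plus one elementary topological lemma.  Companion text and
DATA: `run/shared/lean/pub/pub-rhpf/FAKES.md §4.10` (THEOREM F4-D, TABLE 4.10-T).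

## The dictionary (FAKES.md §4, family 4 = Steinhaus / random completely multiplicative twists)

A Steinhaus point `f : ℕ → 𝕋` replaces ζ's prime term `P(k) = Σ Λ(n) n^{-1/2} (k(log n) + k(-log n))` by the
HERMITIAN twisted prime term `P_f(k) = Σ Λ(n) n^{-1/2} (f(n) k(log n) + conj f(n) k(-log n))` (`steinhausPrimeTerm`).
The VERTICAL CHARACTERS `f_t(n) = n^{it}` (`verticalCharacter`) form a one-parameter subgroup of the Steinhaus torus
whose image on the primes below any cutoff is dense (Kronecker, since the `log p` are ℚ-linearly independent) and
equidistributed for Haar measure (Kronecker–Weyl) — the classical fact behind "a random multiplicative function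
models a random vertical translate of ζ", cited here only in prose. [cite: folklore; H. Bohr (1913), B. Jessen–A. Wintner,
Trans. AMS 38 (1935) 48–88, §§ on almost periodicity of ζ(σ+it)]

## PROVED here (all `t : ℝ`, all `g k : ℝ → ℂ`, no hypotheses)

Write `(M_t g)(x) = e^{itx} g(x)` (`modulate`).  Then
* `weilReflect_modulate`, `weilConv_modulate`: `M_t` commutes with `g ↦ g̃` and `M_t g ⋆ M_t h = M_t (g ⋆ h)`; hence
  `M_t g ⋆ (M_t g)~ = M_t (g ⋆ g̃)`;
* `weilMellin_modulate`: `(M_t k)^(s) = k̂(s + it)` — modulation IS the vertical shift of the Mellin side;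
* `weilPrimeTerm_modulate`: `P(M_t k) = P_{f_t}(k)` with `f_t(n) = n^{it}` — on the prime side the vertical shift IS the
  Steinhaus twist by the vertical character;
* `weilArchIntegral_modulate`: the archimedean integral of `M_t k` is ζ's with the digamma weight recentred at height `t`
  (`shiftedArchIntegral`; translation invariance of Lebesgue measure), and `(M_t k)(0) = k(0)`;
* `weilFunctional_modulate`, `weilQuadratic_modulate`: `W(M_t k) = W^{(t)}(k)` and `Q(M_t g) = W^{(t)}(g ⋆ g̃)`, where
  `W^{(t)} := (k̂(it) + k̂(1+it)) − P_{f_t}(k) + (arch recentred at t)` (`dressedFunctional`) is the Steinhaus twist `f_t`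
  COHERENTLY DRESSED, i.e. with polar and archimedean terms moved to the same height;
* `isWeilTest_modulate`, `tsupport_modulate`, `modulate_modulate`, `modulate_zero`: `M_t` is a bijection of the test space
  of every window `[-a, a]`;
* THEOREM F4-D (a) `weilPositivityOn_iff_dressedTranslate`: for EVERY `t`, `WeilPositivityOn a ↔` (the coherently
  dressed translate `W^{(t)}` is window-positive on `[-a, a]`).  So the coherently dressed members `f_t` of the Steinhaus
  family carry EXACTLY ζ's window-positivity data at every depth: nothing the campaign's window functionals measure can
  separate them from ζ, at any `(λ, N)`.
* `eq_of_invariant_of_denseOrbit` (F4-D (c), abstract kernel): a continuous function invariant under a flow is constant on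
  the closure of any orbit; with Kronecker density (hypothesis `hdense`, not proved here) a continuous functional of the
  prime table that is invariant under vertical translation is CONSTANT on the whole Steinhaus torus of the window's primes,
  i.e. cannot distinguish ζ from any fake of family 4.

## What is NOT claimed

Nothing about the INCOHERENTLY dressed twist (Steinhaus phases with ζ's `t = 0` dressing), which is the object of
TABLE 4.10-T (DATA: it loses positive semidefiniteness at `t*(a,N) ≍ √(ε₁^even ε₁^odd)/|d|`, certified in Arb); nothing
about ζ.  The labels PROVED-Lean (this file) / PROVED-classical (Kronecker–Weyl) / DATA are kept apart in FAKES.md §4.10.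
-/

open Complex Filter Set MeasureTheory
open scoped Real Topology ComplexConjugate ArithmeticFunction.vonMangoldt ContDiff

namespace Summit.RiemannHypothesis.RiemannHypothesis.Theorems.PfPersistenceVerticalShift

open Literature.NumberTheory.LFunctions

noncomputable section

/-! ## Modulation `(M_t g)(x) = e^{itx} g(x)` -/

/-- Modulation by the vertical height `t`: `(M_t g)(x) = e^{itx} g(x)`.  Multiplicatively (`x = log y`) this is
`g(y) ↦ y^{it} g(y)`, the test-function side of the vertical shift `s ↦ s + it`. [folklore] -/
def modulate (t : ℝ) (g : ℝ → ℂ) : ℝ → ℂ :=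
  fun x ↦ cexp (t * x * I) * g x

/-- Unfolding `modulate`. [folklore] -/
theorem modulate_apply (t : ℝ) (g : ℝ → ℂ) (x : ℝ) : modulate t g x = cexp (t * x * I) * g x := rfl

/-- `M_0 = id`. [folklore] -/
theorem modulate_zero (g : ℝ → ℂ) : modulate 0 g = g := by
  ext x; simp [modulate]

/-- `(M_t g)(0) = g(0)`: modulation does not move the value at the origin (the `-g(0) log π` part of the archimedean
term is unchanged). [folklore] -/
theorem modulate_apply_zero (t : ℝ) (g : ℝ → ℂ) : modulate t g 0 = g 0 := by
  simp [modulate]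

/-- `M_s ∘ M_t = M_{s+t}` (so `M_{-t}` inverts `M_t`). [folklore] -/
theorem modulate_modulate (s t : ℝ) (g : ℝ → ℂ) : modulate s (modulate t g) = modulate (s + t) g := by
  ext x
  simp only [modulate]
  push_cast
  rw [← mul_assoc, ← Complex.exp_add]
  congr 2
  ring

/-- The support of `M_t g` is the support of `g` (the phase factor never vanishes). [folklore] -/
theorem support_modulate (t : ℝ) (g : ℝ → ℂ) : Function.support (modulate t g) = Function.support g := by
  unfold modulate
  rw [Function.support_mul]
  rw [show Function.support (fun x : ℝ ↦ cexp (t * x * I)) = Set.univ from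
      Set.eq_univ_of_forall fun x ↦ Function.mem_support.mpr (Complex.exp_ne_zero _), Set.univ_inter]

/-- The topological support of `M_t g` is that of `g`: `M_t` preserves every window `[-a, a]`. [folklore] -/
theorem tsupport_modulate (t : ℝ) (g : ℝ → ℂ) : tsupport (modulate t g) = tsupport g := by
  rw [tsupport, tsupport, support_modulate]

/-- The phase `x ↦ e^{itx}` is smooth. [folklore] -/
theorem contDiff_verticalPhase (t : ℝ) : ContDiff ℝ ∞ (fun x : ℝ ↦ cexp (t * x * I)) := by
  have h1 : ContDiff ℝ ∞ (fun x : ℝ ↦ (t : ℂ) * (x : ℂ) * I) :=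
    (contDiff_const.mul Complex.ofRealCLM.contDiff).mul contDiff_const
  exact Complex.contDiff_exp.comp h1

/-- `M_t` preserves Weil test functions (smooth, compactly supported). [folklore] -/
theorem isWeilTest_modulate (t : ℝ) {g : ℝ → ℂ} (hg : IsWeilTest g) : IsWeilTest (modulate t g) := by
  refine ⟨(contDiff_verticalPhase t).mul hg.1, ?_⟩
  unfold modulate
  exact hg.2.mul_left

/-! ## `M_t` versus the involution and the convolution -/

/-- `(M_t g)~ = M_t (g̃)`: modulation commutes with the involution `g̃(x) = conj g(-x)`. [folklore] -/
theorem weilReflect_modulate (t : ℝ) (g : ℝ → ℂ) : weilReflect (modulate t g) = modulate t (weilReflect g) := by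
  ext x
  simp only [weilReflect, modulate, map_mul, ← Complex.exp_conj, Complex.conj_ofReal, Complex.conj_I]
  push_cast
  ring_nf

/-- `M_t g ⋆ M_t h = M_t (g ⋆ h)` (`e^{itu} e^{it(x-u)} = e^{itx}` under the integral). [folklore] -/
theorem weilConv_modulate (t : ℝ) (g h : ℝ → ℂ) :
    weilConv (modulate t g) (modulate t h) = modulate t (weilConv g h) := by
  ext x
  simp only [weilConv_apply, modulate]
  rw [← integral_const_mul]
  congr 1; ext u
  have key : cexp (t * u * I) * cexp (t * ((x - u : ℝ) : ℂ) * I) = cexp (t * x * I) := by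
    rw [← Complex.exp_add]; congr 1; push_cast; ring
  rw [← key]; ring

/-- The quadratic argument transforms covariantly: `M_t g ⋆ (M_t g)~ = M_t (g ⋆ g̃)`. [folklore] -/
theorem weilConv_weilReflect_modulate (t : ℝ) (g : ℝ → ℂ) :
    weilConv (modulate t g) (weilReflect (modulate t g)) = modulate t (weilConv g (weilReflect g)) := by
  rw [weilReflect_modulate, weilConv_modulate]

/-! ## The three sides under `M_t` -/

/-- MELLIN SIDE: `(M_t k)^(s) = k̂(s + it)` — modulation is the vertical shift. [folklore] -/
theorem weilMellin_modulate (t : ℝ) (k : ℝ → ℂ) (s : ℂ) :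
    weilMellin (modulate t k) s = weilMellin k (s + t * I) := by
  unfold weilMellin modulate
  congr 1; ext x
  have key : cexp (t * x * I) * cexp ((s - 1 / 2) * x) = cexp ((s + t * I - 1 / 2) * x) := by
    rw [← Complex.exp_add]; congr 1; ring
  rw [← key]; ring

/-- POLAR SIDE: `(M_t k)^(0) + (M_t k)^(1) = k̂(it) + k̂(1 + it)` — the pole of ζ seen from height `t`. [folklore] -/
theorem weilPolarTerm_modulate (t : ℝ) (k : ℝ → ℂ) :
    weilPolarTerm (modulate t k) = weilMellin k (t * I) + weilMellin k (1 + t * I) := by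
  unfold weilPolarTerm
  rw [weilMellin_modulate, weilMellin_modulate, zero_add]

/-- The HERMITIAN twisted prime term of a Steinhaus point `f : ℕ → ℂ` (intended `|f| = 1`, completely multiplicative):
`P_f(k) = Σₙ Λ(n) n^{-1/2} (f(n) k(log n) + conj f(n) k(-log n))`.  For `f ≡ 1` it is `weilPrimeTerm`.  This is the
prime term of the window form of a FAMILY-4 fake (FAKES.md §4.0); its real part on real-parity test data is the
"real shadow" `Λ Re f` of §4.1. [folklore] -/
def steinhausPrimeTerm (f : ℕ → ℂ) (k : ℝ → ℂ) : ℂ :=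
  ∑' n : ℕ, ((Λ n : ℝ) : ℂ) / (Real.sqrt n : ℂ) * (f n * k (Real.log n) + conj (f n) * k (-Real.log n))

/-- The vertical character at height `t`: `f_t(n) = n^{it} = e^{it log n}` (completely multiplicative, unimodular). [folklore] -/
def verticalCharacter (t : ℝ) : ℕ → ℂ :=
  fun n ↦ cexp (t * Real.log n * I)

/-- Unfolding `verticalCharacter`. [folklore] -/
theorem verticalCharacter_apply (t : ℝ) (n : ℕ) : verticalCharacter t n = cexp (t * Real.log n * I) := rfl

/-- `f_t` is unimodular: `‖n^{it}‖ = 1`. [folklore] -/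
theorem norm_verticalCharacter (t : ℝ) (n : ℕ) : ‖verticalCharacter t n‖ = 1 := by
  rw [verticalCharacter_apply, show (t : ℂ) * (Real.log n : ℂ) * I = ((t * Real.log n : ℝ) : ℂ) * I by push_cast; ring,
    Complex.norm_exp_ofReal_mul_I]

/-- `f_t` is completely multiplicative on positive integers: `(mn)^{it} = m^{it} n^{it}`. [folklore] -/
theorem verticalCharacter_mul (t : ℝ) {m n : ℕ} (hm : m ≠ 0) (hn : n ≠ 0) :
    verticalCharacter t (m * n) = verticalCharacter t m * verticalCharacter t n := by
  simp only [verticalCharacter_apply, ← Complex.exp_add]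
  congr 1
  push_cast
  rw [Real.log_mul (Nat.cast_ne_zero.mpr hm) (Nat.cast_ne_zero.mpr hn)]
  push_cast
  ring

/-- PRIME SIDE: `P(M_t k) = P_{f_t}(k)` — under modulation ζ's prime term becomes the Hermitian Steinhaus prime term of
the vertical character `n^{it}`: the vertical shift IS a member of family 4 on the prime side. [folklore] -/
theorem weilPrimeTerm_modulate (t : ℝ) (k : ℝ → ℂ) :
    weilPrimeTerm (modulate t k) = steinhausPrimeTerm (verticalCharacter t) k := by
  unfold weilPrimeTerm steinhausPrimeTerm verticalCharacter modulate
  congr 1; ext n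
  congr 1
  rw [← Complex.exp_conj]
  simp only [map_mul, Complex.conj_ofReal, Complex.conj_I]
  push_cast
  ring_nf

/-- ζ's archimedean integral with the digamma weight RECENTRED at height `t`:
`∫ k̂(1/2 + iτ) Re ψ(1/4 + i(τ - t)/2) dτ`.  At `t = 0` it is `weilArchIntegral k`. [folklore] -/
def shiftedArchIntegral (t : ℝ) (k : ℝ → ℂ) : ℂ :=
  ∫ τ : ℝ, weilMellin k (1 / 2 + τ * I) * ((Complex.digamma (1 / 4 + (τ - t) / 2 * I)).re : ℂ)

/-- At height `0` the recentred archimedean integral is ζ's. [folklore] -/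
theorem shiftedArchIntegral_zero (k : ℝ → ℂ) : shiftedArchIntegral 0 k = weilArchIntegral k := by
  simp [shiftedArchIntegral, weilArchIntegral]

/-- ARCHIMEDEAN SIDE: the archimedean integral of `M_t k` is ζ's integral with the digamma weight recentred at `t`
(substitute `τ ↦ τ - t`; translation invariance of Lebesgue measure, no integrability needed). [folklore] -/
theorem weilArchIntegral_modulate (t : ℝ) (k : ℝ → ℂ) :
    weilArchIntegral (modulate t k) = shiftedArchIntegral t k := by
  unfold weilArchIntegral shiftedArchIntegral
  simp_rw [weilMellin_modulate]
  have h := integral_add_right_eq_self (μ := volume)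
    (fun τ : ℝ ↦ weilMellin k (1 / 2 + τ * I) * ((Complex.digamma (1 / 4 + (τ - t) / 2 * I)).re : ℂ)) t
  rw [← h]
  congr 1; ext τ
  push_cast
  simp only [add_sub_cancel_right, add_mul, add_assoc]

/-- The archimedean TERM of `M_t k`: `(1/2π) · (recentred integral) - k(0) log π`. [folklore] -/
theorem weilArchTerm_modulate (t : ℝ) (k : ℝ → ℂ) :
    weilArchTerm (modulate t k) = (1 / (2 * π) : ℂ) * shiftedArchIntegral t k - k 0 * (Real.log π : ℂ) := by
  unfold weilArchTerm
  rw [weilArchIntegral_modulate, modulate_apply_zero]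

/-! ## The coherently dressed translate and THEOREM F4-D (a) -/

/-- ζ's Weil functional DRESSED AT HEIGHT `t` with the Steinhaus point `f_t = n^{it}`:
`W^{(t)}(k) := (k̂(it) + k̂(1 + it)) - P_{f_t}(k) + ((1/2π) ∫ k̂(1/2+iτ) Re ψ(1/4 + i(τ-t)/2) dτ - k(0) log π)`.
Prime side = the family-4 member `f_t`; polar and archimedean sides = ζ's, moved COHERENTLY to the same height.
(The INCOHERENT dressing — `f_t` on the primes with ζ's `t = 0` polar/arch terms — is the object of TABLE 4.10-T.) [folklore] -/
def dressedFunctional (t : ℝ) (k : ℝ → ℂ) : ℂ :=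
  (weilMellin k (t * I) + weilMellin k (1 + t * I)) - steinhausPrimeTerm (verticalCharacter t) k
    + ((1 / (2 * π) : ℂ) * shiftedArchIntegral t k - k 0 * (Real.log π : ℂ))

/-- At height `0` the dressed functional is ζ's Weil functional. [folklore] -/
theorem dressedFunctional_zero (k : ℝ → ℂ) : dressedFunctional 0 k = weilFunctional k := by
  have h := weilPrimeTerm_modulate 0 k
  rw [modulate_zero] at h
  simp [dressedFunctional, weilFunctional, weilPolarTerm, weilArchTerm, shiftedArchIntegral_zero, h]

/-- `W(M_t k) = W^{(t)}(k)`: the Weil functional of a modulated test function is the coherently dressed Steinhaus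
functional. [folklore] -/
theorem weilFunctional_modulate (t : ℝ) (k : ℝ → ℂ) : weilFunctional (modulate t k) = dressedFunctional t k := by
  unfold weilFunctional dressedFunctional
  rw [weilPolarTerm_modulate, weilPrimeTerm_modulate, weilArchTerm_modulate]

/-- `Q(M_t g) = W^{(t)}(g ⋆ g̃)`: Weil's quadratic functional at the modulated test function is the coherently dressed
translate's window form at `g`. [folklore] -/
theorem weilQuadratic_modulate (t : ℝ) (g : ℝ → ℂ) :
    weilQuadratic (modulate t g) = dressedFunctional t (weilConv g (weilReflect g)) := by
  unfold weilQuadratic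
  rw [weilConv_weilReflect_modulate, weilFunctional_modulate]

/-- Window positivity is invariant under modulation of the test space: for every height `t`,
`WeilPositivityOn a ↔ ∀ g` test with `supp g ⊆ [-a,a]`, `0 ≤ Re Q(M_t g)`. (`M_t` is a support-preserving bijection of
the test space, inverse `M_{-t}`.) [folklore] -/
theorem weilPositivityOn_iff_modulate (a t : ℝ) :
    WeilPositivityOn a ↔
      ∀ g : ℝ → ℂ, IsWeilTest g → tsupport g ⊆ Icc (-a) a → 0 ≤ (weilQuadratic (modulate t g)).re := by
  constructor
  · intro h g hg hsupp
    exact h _ (isWeilTest_modulate t hg) (by rwa [tsupport_modulate])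
  · intro h g hg hsupp
    have h' := h (modulate (-t) g) (isWeilTest_modulate (-t) hg) (by rwa [tsupport_modulate])
    rwa [modulate_modulate, add_neg_cancel, modulate_zero] at h'

/-- THEOREM F4-D (a) (ORBIT DICTIONARY / DRESSING COHERENCE).  For every window `a` and every height `t`:
ζ is window-positive on `[-a, a]` iff the coherently dressed Steinhaus member `f_t = n^{it}` is, i.e. iff
`Re W^{(t)}(g ⋆ g̃) ≥ 0` for all tests `g` supported in `[-a, a]`.  Hence the coherently dressed vertical translates — a
Kronecker-dense one-parameter family inside the Steinhaus torus of the window's primes — agree with ζ on EVERYTHING the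
window functionals measure, at every depth `(λ, N)`; whatever distinguishes ζ from family 4 in the campaign's data is the
COHERENCE of the dressing (polar + archimedean terms at the same height as the prime phases), not the values of the
phases.  RH-free; no claim about ζ. [folklore] -/
theorem weilPositivityOn_iff_dressedTranslate (a t : ℝ) :
    WeilPositivityOn a ↔
      ∀ g : ℝ → ℂ, IsWeilTest g → tsupport g ⊆ Icc (-a) a →
        0 ≤ (dressedFunctional t (weilConv g (weilReflect g))).re := by
  rw [weilPositivityOn_iff_modulate a t]
  simp only [weilQuadratic_modulate]

/-- COROLLARY: window positivity of the coherently dressed translate does not depend on the height. [folklore] -/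
theorem dressedTranslate_nonneg_iff (a s t : ℝ) :
    (∀ g : ℝ → ℂ, IsWeilTest g → tsupport g ⊆ Icc (-a) a →
        0 ≤ (dressedFunctional s (weilConv g (weilReflect g))).re) ↔
      ∀ g : ℝ → ℂ, IsWeilTest g → tsupport g ⊆ Icc (-a) a →
        0 ≤ (dressedFunctional t (weilConv g (weilReflect g))).re := by
  rw [← weilPositivityOn_iff_dressedTranslate a s, ← weilPositivityOn_iff_dressedTranslate a t]

/-! ## THEOREM F4-D (c), abstract kernel: orbit invariance forces constancy -/

/-- ORBIT NO-GO (abstract kernel of THEOREM F4-D (c)).  A continuous map `F` that is invariant under a flow `Φ` is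
constant on the closure of every orbit; if one orbit is dense, `F` is constant.  Application (prose only; the density
is Kronecker's theorem, taken as the hypothesis `hdense`): a continuous functional of the window's prime-phase table
`(f(p))_{p ≤ e^{2a}} ∈ 𝕋^π` that is invariant under vertical translation `f(p) ↦ p^{it} f(p)` takes the same value at
ζ (`f ≡ 1`) as at EVERY Steinhaus fake — such functionals (all moments, all translation-averaged statistics) cannot
see the difference; only dressing-coherent (non-invariant) functionals such as the window forms can. [folklore] -/
theorem eq_of_invariant_of_denseOrbit {X Y : Type*} [TopologicalSpace X] [TopologicalSpace Y] [T2Space Y]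
    (Φ : ℝ → X → X) (F : X → Y) (hF : Continuous F) (hinv : ∀ t x, F (Φ t x) = F x)
    (x₀ : X) (hdense : Dense (Set.range fun t : ℝ ↦ Φ t x₀)) (x : X) : F x = F x₀ := by
  have hclosed : IsClosed {y : X | F y = F x₀} := isClosed_eq hF continuous_const
  have hsub : Set.range (fun t : ℝ ↦ Φ t x₀) ⊆ {y | F y = F x₀} := by
    rintro _ ⟨t', rfl⟩
    exact hinv t' x₀
  have hx : x ∈ closure (Set.range fun t : ℝ ↦ Φ t x₀) := by
    rw [hdense.closure_eq]; trivial
  exact hclosed.closure_subset_iff.mpr hsub hx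


end

end Summit.RiemannHypothesis.RiemannHypothesis.Theorems.PfPersistenceVerticalShift
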